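import Summits.BirchSwinnertonDyer.Rank1Residual.Additive.TameBranchAnalyticShaOddPrime
import Summits.BirchSwinnertonDyer.Rank1Residual.Additive.TameBranchAnalyticShaRankOne
import HarnessLib

/-!
# RANK ONE AT EVERY ODD `p`, `p = 3` INCLUDED — X4♯(G-ord, `e = 2`) ∩ {`ρ̄` onto}: the A′-inequality
# ALONE (+ `[T¹](ϖ·B^±) ≠ 0`) gives `TameBranchRatCharEqAt W p`, Schneider, `ord_p Reg_p = v`,
# `#Ш[p^∞] = 1` and `char_Λ X = (Kato element)` with the (B)-datum a BINDER — the 7 X4 Gord window rows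
# at `p = 3` left out by gen 31/32 (cell `b2b-bsdres`, sub-cell additive-p2, gen 33; part 5)

HONEST FRAMING (cell `b2b-bsdres`, run/shared/lean/b2b/bsd-rank1-residual/, verbatim in every
file): the goal of the cell is to DELETE the COMBINATION-SHAPED residual classes of the
Birch–Swinnerton-Dyer formula for ALL analytic-rank `≤ 1` elliptic curves over `ℚ` — "full BSD
formula for every rank `≤ 1` curve in class `C`" assembled STRICTLY from published theorems — so
that the rank-`≤ 1` remainder becomes exactly the CONSTRUCTION-SHAPED classes, which are TYPED
(missing-input `Prop`s), NOT attempted. This is not "finishing BSD". Sub-cell additive-p2: the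
classes X3♯(G-ord) / X4♯(G-ord) are CONSTRUCTION-SHAPED and stay so; labels / RESIDUAL-MAP marks
UNCHANGED; nothing is booked. Theorems only; published inputs are explicit binders (`hK` Kato 2004
Thm. 17.4 (3), `hmodD` BCDT, `hGZK`, the (B)-datum `LeadingTermClauses W p Dh` — A175 at `p ≥ 5`,
`Delbourgo2002.mainTheorem_three` at `p = 3`); the A′-inequality and `[T¹] ≠ 0` are per-pair certificate
HYPOTHESES (census X4-2 WINDOW: EVIDENCE). BSD_p at rank 1 is NOT claimed (`Reg_p ↔ h` is the located gap).
No definition, no named fact, no `sorry`.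

## What and why

Gen 32 part 3 proved, at **`p ≥ 5`**: on X4♯(G-ord) ∩ `I₀*` ∩ {`ρ̄_{E,p}` onto}, `rank_ℤ E(ℚ) = 1`, a
(B)-datum `Dh`, the per-pair data `[T¹](ϖ·B^±) ≠ 0`, `v ≤ ord_p Reg_p(E,Dh)` and the A′-inequality
`v_p([T¹](ϖ·B^±)) + 1 + 2·ord_p #tors ≤ v + ord_p ∏c` give, for every cyclotomic dual datum, Schneider,
`ord_p Reg_p = v`, `#Ш[p^∞] = 1` and `char_Λ X = (Kato element)`; class level `TameBranchRatCharEqAt W p`.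
The `p ≥ 5` entered ONLY through Serre's lifting of surj(p) to the tower of the twist and through A175's
(B)-datum. Part 1 of gen 33 (`towerSurj_twist_of_goodOrd_of_surj`: lit-kato's PROVED good-ordinary case
of Wuthrich's Lemma 20) removes the first; taking the (B)-datum as a binder removes the second. So:

* §1 `ClassX4Gord.charIdeal_eq_span_kato_of_linearCoeff_rankOne_odd` — the core at every odd `p`;
* §2 `ClassX4Gord.tameBranchRatCharEqAt_of_katoHalf_of_linearCoeff_rankOne_odd` — the headline at every
  odd `p`; `…_three` — the `p = 3` instance with the binder discharged by `mainTheorem_three` (non-CM) and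
  `e = 2` automatic (`ClassX4Gord.semistabilityIndex_three`' twin inline: Tate's algorithm at `3`).

Census pointer (EVIDENCE; nothing booked): the X4-2 WINDOW (cp-bsd-w2, 429 rank-1 defect-2 rows,
`v_p(A′) = v_h + ord_p(#Ш_an∏c/#T²)` on 429/429) has 7 X4 Gord rows at `p = 3`, the only window rows
outside gen 31/32's class-level statements; they are §2's rows (given `Reg_p ↔ h`, as everywhere at
rank 1). References: Kato 2004 Thm. 17.4 (3) [Kato2004Asterisque]; Wuthrich 2014 Lemma 20 [Wuthrich2014];
Delbourgo 2002 Thm. (A), (B) [Delbourgo2002]; Greenberg LNM 1716 §4 [GreenbergLNM1716]; gen 32 part 3;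
gen 33 part 1. -/

set_option autoImplicit false

noncomputable section

open scoped Classical MatrixGroups ModularForm NumberField

open CongruenceSubgroup IsDedekindDomain WeierstrassCurve NumberField
  Literature.NumberTheory.EllipticCurves
  Literature.NumberTheory.EllipticCurves.ModularForms
  Literature.NumberTheory.EllipticCurves.Rank1Residual
  Literature.NumberTheory.EllipticCurves.Rank1Residual.Typed
  Literature.NumberTheory.EllipticCurves.Delbourgo2002
  Literature.NumberTheory.GaloisRepresentations
  Summit.BirchSwinnertonDyer.Rank1Residual.AdditivePotMult
  Summit.BirchSwinnertonDyer.Rank1Residual.X1.MuLambda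
  Summit.BirchSwinnertonDyer.Rank1Residual.X1.RankOneParitySqueeze
  Summit.BirchSwinnertonDyer.Rank1Residual.X11a.LambdaNorm

namespace Summit.BirchSwinnertonDyer.Rank1Residual.Additive

section RankOneOdd

open TameBranchMuPart TameBranchAnalyticSha

variable {W : WeierstrassCurve ℚ} [W.IsElliptic] [W.IsGloballyMinimal] {p : ℕ} [hp : Fact p.Prime]

omit [W.IsGloballyMinimal] in
/-- **§1 THE CORE AT RANK ONE, EVERY ODD `p` ((B)-datum a binder).** X4♯(G-ord) ∩ {`ρ̄_{E,p}` onto},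
`p` odd, `rank_ℤ E(ℚ) = 1`, a (B)-datum `Dh`; `V = E♭` globally minimal good ordinary at `p`,
`C • V^{(p*)} = W`, `f` a newform of `V`, `ϖ` the period ratio; data: **`[T¹](ϖ·B^±) ≠ 0`**,
`v ≤ ord_p Reg_p(E,Dh)`, **`v_p([T¹](ϖ·B^±)) + 1 + 2·ord_p #E(ℚ)_tors ≤ v + ord_p ∏c_ℓ`**. Then for every
cyclotomic dual datum: `X` torsion, Schneider, **`ord_p Reg_p(E,Dh) = v`**, **`#Ш(E/ℚ)[p^∞] = 1`**, and the
Kato element `g` has **`char_Λ X = (g)`**, **`ι g = u·ϖ·B^±`**, every generator `fE` having `μ(fE) = μ(g)`,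
`λ(fE) = λ(g)`. Gen 32's `…_linearCoeff_rankOne` with `p ≥ 5 ↦ p ≠ 2`. [cite: Kato2004Asterisque, Thm. 17.4 (3) (p. 273)]
[cite: Wuthrich2014, Lemma 20 (p. 399)] [cite: Delbourgo2002, Theorem (B) (p. 40)] [cite: GreenbergLNM1716, §4 pp. 102–110] -/
theorem ClassX4Gord.charIdeal_eq_span_kato_of_linearCoeff_rankOne_odd
    (hK : Wuthrich2014.kato_halfEigenCharIdeal_dvd_cyclotomicPrime_of_surjective)
    (hX : ClassX4Gord W p) (hsurj : Surj W p) (hr1 : W.mordellWeilRank = 1)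
    {Dh : PAdicHeightData W p} (hBcl : LeadingTermClauses W p Dh)
    (V : WeierstrassCurve ℚ) [V.IsElliptic] [V.IsGloballyMinimal] (C : VariableChange ℚ)
    (hC : C • V.quadraticTwist ((-1 : ℚ) ^ (p / 2) * p) = W) (hV : GoodOrd V p)
    {N : ℕ} [NeZero N] {f : CuspForm (Gamma0 N) 2} (hf : IsNewformOf V f)
    (ϖ : ℚ) (hϖ : if Even (p / 2) then (ϖ : ℝ) * V.realPeriodRat = plusPeriod f
      else (ϖ : ℝ) * V.imaginaryPeriodRat = minusPeriod f)
    (h1 : PowerSeries.coeff 1 (PowerSeries.C (ϖ : ℚ_[p]) *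
      (if Even (p / 2) then padicLFunctionBranch f ((unitRoot V p : ℤ_[p]) : ℚ_[p]) (p / 2)
        else padicLFunctionMinusBranch f ((unitRoot V p : ℤ_[p]) : ℚ_[p]) (p / 2))) ≠ 0)
    {v : ℤ} (hv : v ≤ (padicRegulator Dh).valuation)
    (hfull : (PowerSeries.coeff 1 (PowerSeries.C (ϖ : ℚ_[p]) *
        (if Even (p / 2) then padicLFunctionBranch f ((unitRoot V p : ℤ_[p]) : ℚ_[p]) (p / 2)
          else padicLFunctionMinusBranch f ((unitRoot V p : ℤ_[p]) : ℚ_[p]) (p / 2)))).valuation +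
        1 + 2 * padicValNat p W.torsionOrder ≤ v + padicValNat p W.tamagawaProduct)
    {κ : ZpExtension ℚ p} {γ : Field.absoluteGaloisGroup ℚ}
    (hκ : κ.IsCyclotomic) (hγ : κ.IsTopGenerator γ) (hγ' : IsCyclotomicVariable p γ)
    (D : W.SelmerDualData κ γ) :
    D.IsTorsion ∧ SchneiderConjecture Dh ∧ (padicRegulator Dh).valuation = v ∧
      Nat.card (AddCommGroup.primaryComponent W.sha p) = 1 ∧
      ∃ (g : IwasawaAlgebra p) (u : ℤ_[p]ˣ), D.charIdeal = Ideal.span {g} ∧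
        iwasawaToPowerSeries p g =
          PowerSeries.C (((u : ℤ_[p]) : ℚ_[p]) * (ϖ : ℚ_[p])) *
            (if Even (p / 2) then padicLFunctionBranch f ((unitRoot V p : ℤ_[p]) : ℚ_[p]) (p / 2)
              else padicLFunctionMinusBranch f ((unitRoot V p : ℤ_[p]) : ℚ_[p]) (p / 2)) ∧
        ∀ fE : IwasawaAlgebra p, D.charIdeal = Ideal.span {fE} → mu fE = mu g ∧ lam fE = lam g := by
  have hp2 : p ≠ 2 := hX.addv.1
  have hj := padicValRat_j_nonneg_of_typeGOrd W p hX.typeGOrd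
  have hsurjV : ∀ m : ℕ, V.HasSurjectiveModNGaloisRep (p ^ m : ℕ) :=
    towerSurj_twist_of_goodOrd_of_surj hp2 hsurj V C hC hV
  haveI : Module.Finite (IwasawaAlgebra p) D.X :=
    SelmerDualData.module_finite_of_isCyclotomic (W := W) (κ := κ) hκ D hγ
  obtain ⟨hXt, g, hg, u, hι⟩ := isTorsion_and_exists_iota_eq_branch_of_katoComponent W p
    (Kato2004.charIdeal_dvd_padicLFunctionBranch_component_of_surjective_of_half hK) hj hp2 V
    ⟨C, hC⟩ (Or.inl hV) hsurjV hκ hγ hγ' hf D ϖ hϖ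
  have hX1 : PowerSeries.coeff 1 (PowerSeries.C (((u : ℤ_[p]) : ℚ_[p]) * (ϖ : ℚ_[p])) *
      (if Even (p / 2) then padicLFunctionBranch f ((unitRoot V p : ℤ_[p]) : ℚ_[p]) (p / 2)
        else padicLFunctionMinusBranch f ((unitRoot V p : ℤ_[p]) : ℚ_[p]) (p / 2))) ≠ 0 := by
    rw [PowerSeries.coeff_C_mul, mul_assoc]
    rw [PowerSeries.coeff_C_mul] at h1
    exact mul_ne_zero (coe_units_ne_zero p u) h1
  have hfull' := hfull
  rw [← valuation_coeff_C_unit_mul u _ _ 1 h1] at hfull'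
  haveI : (Literature.NumberTheory.EllipticCurves.Module.charIdeal (IwasawaAlgebra p) D.X).IsPrincipal :=
    charIdeal_isPrincipal_holds p D.X
  obtain ⟨fE, hchar⟩ := Submodule.IsPrincipal.principal
    (Literature.NumberTheory.EllipticCurves.Module.charIdeal (IwasawaAlgebra p) D.X)
  obtain ⟨hS, hspan, -, -, hcard, hReg, -⟩ := fullSqueeze_rankOne_of_iota_eq hp2 hr1 hBcl hκ hγ hγ' D
    hXt hchar hg hι hX1 hv hfull'
  refine ⟨hXt, hS, hReg, hcard, g, u, hspan, hι, fun fE' hchar' ↦ ?_⟩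
  obtain ⟨-, -, hμ, hlam, -⟩ := fullSqueeze_rankOne_of_iota_eq hp2 hr1 hBcl hκ hγ hγ' D hXt hchar' hg hι
    hX1 hv hfull'
  exact ⟨hμ, hlam⟩

/-- **§2 HEADLINE, RANK ONE, EVERY ODD `p`: THE A′-INEQUALITY ALONE ((B)-datum a binder).** X4♯(G-ord)
∩ `I₀*` ∩ {`ρ̄_{E,p}` onto}, `p` odd (`p = 3` included), `ord_{s=1} L(E,s) = 1`, a (B)-datum `Dh`, a
certified `v ≤ ord_p Reg_p(E,Dh)`; per pair ONLY **`[T¹](ϖ·B^±) ≠ 0`** and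
**`v_p([T¹](ϖ·B^±)) + 1 + 2·ord_p #tors ≤ v + ord_p ∏c_ℓ`**. Then **`TameBranchRatCharEqAt W p`**, Schneider,
**`ord_p Reg_p(E,Dh) = v`**, **`#Ш(E/ℚ)[p^∞] = 1`**. [cite: Kato2004Asterisque, Thm. 17.4 (3) (p. 273)]
[cite: Wuthrich2014, Lemma 20 (p. 399)] [cite: Delbourgo2002, Theorem (B) (p. 40)] [cite: GreenbergLNM1716, §4 pp. 102–110] -/
theorem ClassX4Gord.tameBranchRatCharEqAt_of_katoHalf_of_linearCoeff_rankOne_odd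
    (hK : Wuthrich2014.kato_halfEigenCharIdeal_dvd_cyclotomicPrime_of_surjective)
    (hmodD : nonempty_modularParametrizationData)
    (hGZK : rank_eq_analyticRank_of_analyticRank_le_one)
    (hX : ClassX4Gord W p) (he : semistabilityIndex W p = 2) (hsurj : Surj W p)
    (hr : W.analyticRank = 1) {Dh : PAdicHeightData W p} (hBcl : LeadingTermClauses W p Dh)
    {v : ℤ} (hv : v ≤ (padicRegulator Dh).valuation)
    (hcert : ∀ (V : WeierstrassCurve ℚ) [V.IsElliptic] [V.IsGloballyMinimal] (C : VariableChange ℚ),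
      C • V.quadraticTwist ((-1 : ℚ) ^ (p / 2) * p) = W → IsOrdinaryAt V p →
      ∀ {N : ℕ} [NeZero N] (f : CuspForm (Gamma0 N) 2), IsNewformOf V f →
      ∀ ϖ : ℚ, (if Even (p / 2) then (ϖ : ℝ) * V.realPeriodRat = plusPeriod f
          else (ϖ : ℝ) * V.imaginaryPeriodRat = minusPeriod f) →
        PowerSeries.coeff 1 (PowerSeries.C (ϖ : ℚ_[p]) *
            (if Even (p / 2) then padicLFunctionBranch f ((unitRoot V p : ℤ_[p]) : ℚ_[p]) (p / 2)
              else padicLFunctionMinusBranch f ((unitRoot V p : ℤ_[p]) : ℚ_[p]) (p / 2))) ≠ 0 ∧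
        (PowerSeries.coeff 1 (PowerSeries.C (ϖ : ℚ_[p]) *
            (if Even (p / 2) then padicLFunctionBranch f ((unitRoot V p : ℤ_[p]) : ℚ_[p]) (p / 2)
              else padicLFunctionMinusBranch f ((unitRoot V p : ℤ_[p]) : ℚ_[p]) (p / 2)))).valuation +
            1 + 2 * padicValNat p W.torsionOrder ≤ v + padicValNat p W.tamagawaProduct) :
    TameBranchRatCharEqAt W p ∧ SchneiderConjecture Dh ∧ (padicRegulator Dh).valuation = v ∧
      Nat.card (AddCommGroup.primaryComponent W.sha p) = 1 := by
  have hp2 : p ≠ 2 := hX.addv.1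
  obtain ⟨hmw, -⟩ := hGZK W (by rw [hr])
  have hr1 : W.mordellWeilRank = 1 := by rw [hmw, hr]
  obtain ⟨V, iV, iVm, C, hV, hC⟩ := hX.exists_goodOrd_pStar_twist_model W p he
  haveI : NeZero (V.conductorNorm ℤ) := ⟨(V.conductorNorm_pos_holds).ne'⟩
  obtain ⟨Dm⟩ := hmodD V
  obtain ⟨ϖ, hϖ⟩ := exists_periodRatio_parity (p := p) V Dm
  have hj := padicValRat_j_nonneg_of_typeGOrd W p hX.typeGOrd
  have hord : IsOrdinaryAt V p :=
    isOrdinaryAt_of_goodOrd_or_mult_of_model_twist W V (pStar_ne_zero p) ⟨C, hC⟩ hj (Or.inl hV)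
  obtain ⟨h1, hfull⟩ := hcert V C hC hord Dm.f Dm.isNewformOf ϖ hϖ
  have hϖ0 : ϖ ≠ 0 := by
    rintro rfl; apply h1; rw [Rat.cast_zero, map_zero, zero_mul, map_zero]
  have hB0 : (if Even (p / 2) then padicLFunctionBranch Dm.f ((unitRoot V p : ℤ_[p]) : ℚ_[p]) (p / 2)
      else padicLFunctionMinusBranch Dm.f ((unitRoot V p : ℤ_[p]) : ℚ_[p]) (p / 2)) ≠ 0 := by
    intro e; apply h1; rw [e, mul_zero, map_zero]
  have core := fun {κ : ZpExtension ℚ p} {γ : Field.absoluteGaloisGroup ℚ} (hκ : κ.IsCyclotomic)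
      (hγ : κ.IsTopGenerator γ) (hγ' : IsCyclotomicVariable p γ) (D : W.SelmerDualData κ γ) ↦
    hX.charIdeal_eq_span_kato_of_linearCoeff_rankOne_odd hK hsurj hr1 hBcl V C hC hV Dm.isNewformOf ϖ hϖ
      h1 hv hfull hκ hγ hγ' D
  obtain ⟨κ₀, γ₀, hκ₀, hγ₀, hγ₀', D₀, -, -⟩ := exists_cyclotomic_dualData_generator W p
  obtain ⟨-, hS, hReg, hcard, -⟩ := core hκ₀ hγ₀ hγ₀' D₀
  refine ⟨?_, hS, hReg, hcard⟩
  intro κ γ N _ f ε α B _ haddv _ hκ hγ hcv hf _ hα hB D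
  obtain ⟨hXt, -, -, -, g₁, u, hspan, hι, -⟩ := core hκ hγ hcv D
  exact ⟨hXt, exists_charIdeal_eq_span_and_iota_eq_of_generator hp2 V C hC haddv hV hf
    (exists_ratPlusSymbol_ne_zero_of_isNewformOf hf) Dm hϖ0 hspan hι hB0 hα hB⟩

/-- **`p = 3`, RANK ONE: THE A′-INEQUALITY ALONE.** X4♯(G-ord) ∩ {`ρ̄_{E,3}` onto} (`e = 2` automatic at
`3`), `E` non-CM, `ord_{s=1} L(E,s) = 1`; the (B)-datum `Dh` is Delbourgo's at `p = 3`
(`mainTheorem_three`), so the statement quantifies over the data it yields: for SOME (B)-datum `Dh`, every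
certified `v ≤ ord_3 Reg_3(E,Dh)` with the per-pair A′-inequality and `[T¹] ≠ 0` gives
`TameBranchRatCharEqAt W 3`, Schneider, `ord_3 Reg_3 = v`, `#Ш(E/ℚ)[3^∞] = 1`. Census: the 7 X4 Gord rows
at `p = 3` of the X4-2 WINDOW. [cite: Kato2004Asterisque, Thm. 17.4 (3) (p. 273)]
[cite: Delbourgo2002, Theorem (A), (B) (p. 40), Hypothesis (p. 39)] [cite: Wuthrich2014, Lemma 20 (p. 399)] -/
theorem ClassX4Gord.exists_tameBranchRatCharEqAt_three_of_katoHalf_of_linearCoeff_rankOne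
    [Fact (Nat.Prime 3)]
    (hK : Wuthrich2014.kato_halfEigenCharIdeal_dvd_cyclotomicPrime_of_surjective)
    (hmodD : nonempty_modularParametrizationData) (hDel3 : Delbourgo2002.mainTheorem_three)
    (hGZK : rank_eq_analyticRank_of_analyticRank_le_one)
    (hX : ClassX4Gord W 3) (hcm : ¬ W.HasCM) (hsurj : Surj W 3) (hr : W.analyticRank = 1) :
    ∃ Dh : PAdicHeightData W 3, LeadingTermClauses W 3 Dh ∧ ∀ v : ℤ, v ≤ (padicRegulator Dh).valuation →
      (∀ (V : WeierstrassCurve ℚ) [V.IsElliptic] [V.IsGloballyMinimal] (C : VariableChange ℚ),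
        C • V.quadraticTwist ((-1 : ℚ) ^ ((3 : ℕ) / 2) * (3 : ℕ)) = W → IsOrdinaryAt V 3 →
        ∀ {N : ℕ} [NeZero N] (f : CuspForm (Gamma0 N) 2), IsNewformOf V f →
        ∀ ϖ : ℚ, (if Even ((3 : ℕ) / 2) then (ϖ : ℝ) * V.realPeriodRat = plusPeriod f
            else (ϖ : ℝ) * V.imaginaryPeriodRat = minusPeriod f) →
          PowerSeries.coeff 1 (PowerSeries.C (ϖ : ℚ_[3]) *
              (if Even ((3 : ℕ) / 2) then padicLFunctionBranch f ((unitRoot V 3 : ℤ_[3]) : ℚ_[3]) ((3 : ℕ) / 2)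
                else padicLFunctionMinusBranch f ((unitRoot V 3 : ℤ_[3]) : ℚ_[3]) ((3 : ℕ) / 2))) ≠ 0 ∧
          (PowerSeries.coeff 1 (PowerSeries.C (ϖ : ℚ_[3]) *
              (if Even ((3 : ℕ) / 2) then padicLFunctionBranch f ((unitRoot V 3 : ℤ_[3]) : ℚ_[3]) ((3 : ℕ) / 2)
                else padicLFunctionMinusBranch f ((unitRoot V 3 : ℤ_[3]) : ℚ_[3]) ((3 : ℕ) / 2)))).valuation +
              1 + 2 * padicValNat 3 W.torsionOrder ≤ v + padicValNat 3 W.tamagawaProduct) →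
      TameBranchRatCharEqAt W 3 ∧ SchneiderConjecture Dh ∧ (padicRegulator Dh).valuation = v ∧
        Nat.card (AddCommGroup.primaryComponent W.sha 3) = 1 := by
  have he : semistabilityIndex W 3 = 2 := semistabilityIndex_eq_two_of_typeG_three W hX.typeGOrd.typeG hX.addv.2
  obtain ⟨Dh, hBcl⟩ := hX.exists_leadingTermClauses_three hDel3 hcm he
  exact ⟨Dh, hBcl, fun v hv hcert ↦
    hX.tameBranchRatCharEqAt_of_katoHalf_of_linearCoeff_rankOne_odd hK hmodD hGZK he hsurj hr hBcl hv hcert⟩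

end RankOneOdd

end Summit.BirchSwinnertonDyer.Rank1Residual.Additive

end
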